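import Literature.MathematicalPhysics.KineticTheory.SiteChainConfined
import HarnessLib

/-!
# Site-inhomogeneous Langevin chains with confining potentials: the regular confined drift

Topic `Literature/MathematicalPhysics/KineticTheory`, grouping namespace `…KineticTheory.HeatConduction`.
Continuation of `SiteChainConfined.lean` (twin of the second half of `LangevinChainConfined.lean` for the
site-dependent chains `SiteChain` of `CellChain.lean`): the deterministic energy balance along the
Langevin dynamics driven by a bounded momentum forcing, and the packaging of the Langevin drift
`Y = P.langevinDrift N` as a `RegularConfinedDrift` (`ConfinedFlowBounds.lean`) — the input of the model-free SDE
pipeline `ConfinedForcedFlow → ConfinedDriftKernel → ConfinedGeneratorStep → ConfinedDynkin`.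

* `SiteChain.fderiv_hamiltonian_apply` (`DH(y)·v = ∑_i (∂_{q_i}H v_{q,i} + p_i v_{p,i})`),
  `fderiv_hamiltonian_drift_eq_sum/le/ge` (the energy identity
  `DH(y)·Y(y + (0,e)) = ∑_i (∂_{q_i}H e_i - γ w_i p_i² - γ w_i p_i e_i)` and its two-sided bounds);
* consequences of `UniformlyConfining`: regularity, `H ≥ 0`, compact sublevel sets, the constants
  `forceConstU/V`, `energyRate` and the linear energy bound `∑|∂_{q_i}H| + 2γ∑|p_i| ≤ K_E (1 + H)`;
* `SiteChain.UniformlyConfining.confinedDrift : RegularConfinedDrift (P.langevinDrift N)` (energy `H`, `c = 1`,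
  `K(M) = K_E M`, `K'(M) = K_E M + 4γ`, shift constant `N + 1`, radius `levelRadius H`, noise = momenta).

## References

* N. Cuneo, J.-P. Eckmann, M. Hairer, L. Rey-Bellet, Electron. J. Probab. **23** (2018) no. 55, §3 eq. (3.3).
* R. Khasminskii, *Stochastic Stability of Differential Equations* (2nd ed., 2012), Thm 3.5, §3.4.

## Design choices

* Verbatim the proofs of `LangevinChainConfined.lean` with site-indexed potentials; nothing model-specific.
* NOT here: the kernels and the semigroup (`SiteChainLangevinKernel.lean`).
-/

noncomputable section

open MeasureTheory Filter Topology Set Metric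
open scoped NNReal ENNReal ContDiff

namespace Literature.MathematicalPhysics.KineticTheory.HeatConduction

open Literature.MathematicalPhysics.KineticTheory

variable {N : ℕ}

namespace SiteChain

variable (P : SiteChain)

/-! ### The energy balance along the driven Langevin dynamics -/

/-- `DH(y)·v = ∑_i (∂_{q_i}H(y) v_{q,i} + p_i v_{p,i})`. [folklore] -/
theorem fderiv_hamiltonian_apply (hU : ∀ i, ContDiff ℝ 1 (P.U i)) (hV : ∀ i, ContDiff ℝ 1 (P.V i))
    (y v : PhaseSpace N) :
    fderiv ℝ (P.hamiltonian N) y v =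
      ∑ i, (partialQ i (P.hamiltonian N) y * v.1 i + y.2 i * v.2 i) := by
  have hH : Differentiable ℝ (P.hamiltonian N) := (P.contDiff_hamiltonian N hU hV).differentiable one_ne_zero
  rw [clm_apply_eq_sum, ← Finset.sum_add_distrib]
  refine Finset.sum_congr rfl fun i _ => ?_
  have hQ : fderiv ℝ (P.hamiltonian N) y (unitQ i) = partialQ i (P.hamiltonian N) y := by
    rw [partialQ_eq_fderiv hH, unitQ_eq]
  have hP : fderiv ℝ (P.hamiltonian N) y (unitP i) = y.2 i := by
    rw [← P.partialP_hamiltonian N y.1 y.2 i, partialP_eq_fderiv hH, unitP_eq]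
  rw [hQ, hP, smul_eq_mul, smul_eq_mul]
  ring

/-- **The energy identity**: for the Langevin drift `Y` and a momentum perturbation `e`,
`DH(y)·Y(y.1, y.2 + e) = ∑_i (∂_{q_i}H(y) e_i - γ w_i p_i² - γ w_i p_i e_i)` (`w_i = [i = 0] + [i = N-1]`):
the Hamiltonian vector field conserves `H`, the friction dissipates, the forcing injects.
[cite: CuneoEckmannHairerReyBellet2018, §3 eq. (3.3)] -/
theorem fderiv_hamiltonian_drift_eq_sum (hU : ∀ i, ContDiff ℝ 1 (P.U i)) (hV : ∀ i, ContDiff ℝ 1 (P.V i))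
    (y : PhaseSpace N) (e : Fin N → ℝ) :
    fderiv ℝ (P.hamiltonian N) y (P.langevinDrift N (y.1, y.2 + e)) =
      ∑ i, (partialQ i (P.hamiltonian N) y * e i - P.γ * OscillatorChain.bathWeight N i * y.2 i ^ 2 -
        P.γ * OscillatorChain.bathWeight N i * y.2 i * e i) := by
  have hUd : ∀ i, Differentiable ℝ (P.U i) := fun i => (hU i).differentiable one_ne_zero
  have hVd : ∀ i, Differentiable ℝ (P.V i) := fun i => (hV i).differentiable one_ne_zero
  rw [P.fderiv_hamiltonian_apply hU hV]
  simp only [langevinDrift, P.partialQ_hamiltonian_fst hUd hVd, Pi.add_apply]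
  exact Finset.sum_congr rfl fun i _ => by ring

/-- **The upper energy bound** (dissipation dropped):
`DH(y)·Y(y.1, y.2 + e) ≤ ‖e‖ (∑_i |∂_{q_i}H(y)| + 2γ ∑_i |p_i|)` (`γ ≥ 0`). [folklore] -/
theorem fderiv_hamiltonian_drift_le (hU : ∀ i, ContDiff ℝ 1 (P.U i)) (hV : ∀ i, ContDiff ℝ 1 (P.V i))
    (hγ : 0 ≤ P.γ) (y : PhaseSpace N) (e : Fin N → ℝ) :
    fderiv ℝ (P.hamiltonian N) y (P.langevinDrift N (y.1, y.2 + e)) ≤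
      ‖e‖ * ((∑ i, |partialQ i (P.hamiltonian N) y|) + 2 * P.γ * ∑ i, |y.2 i|) := by
  rw [P.fderiv_hamiltonian_drift_eq_sum hU hV]
  have hr : ‖e‖ * ((∑ i, |partialQ i (P.hamiltonian N) y|) + 2 * P.γ * ∑ i, |y.2 i|) =
      ∑ i, (‖e‖ * |partialQ i (P.hamiltonian N) y| + ‖e‖ * 2 * P.γ * |y.2 i|) := by
    rw [mul_add, Finset.mul_sum, Finset.mul_sum, Finset.mul_sum, ← Finset.sum_add_distrib]
    exact Finset.sum_congr rfl fun i _ => by ring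
  rw [hr]
  refine Finset.sum_le_sum fun i _ => ?_
  set a := partialQ i (P.hamiltonian N) y
  set p := y.2 i
  have he : |e i| ≤ ‖e‖ := by rw [← Real.norm_eq_abs]; exact norm_le_pi_norm e i
  have hw0 : 0 ≤ OscillatorChain.bathWeight N i := by
    unfold OscillatorChain.bathWeight; split_ifs <;> norm_num
  have hw2 : OscillatorChain.bathWeight N i ≤ 2 := by
    unfold OscillatorChain.bathWeight; split_ifs <;> norm_num
  have h1 : a * e i ≤ ‖e‖ * |a| := by
    calc a * e i ≤ |a * e i| := le_abs_self _
      _ = |a| * |e i| := abs_mul _ _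
      _ ≤ |a| * ‖e‖ := mul_le_mul_of_nonneg_left he (abs_nonneg _)
      _ = ‖e‖ * |a| := mul_comm _ _
  have h2 : -(P.γ * OscillatorChain.bathWeight N i * p ^ 2) ≤ 0 := by
    have : 0 ≤ P.γ * OscillatorChain.bathWeight N i * p ^ 2 := mul_nonneg (mul_nonneg hγ hw0) (sq_nonneg p)
    linarith
  have h3 : -(P.γ * OscillatorChain.bathWeight N i * p * e i) ≤ ‖e‖ * 2 * P.γ * |p| := by
    calc -(P.γ * OscillatorChain.bathWeight N i * p * e i)
        ≤ |P.γ * OscillatorChain.bathWeight N i * p * e i| := neg_le_abs _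
      _ = P.γ * OscillatorChain.bathWeight N i * (|p| * |e i|) := by
          rw [abs_mul, abs_mul, abs_mul, abs_of_nonneg hγ, abs_of_nonneg hw0]; ring
      _ ≤ P.γ * 2 * (|p| * ‖e‖) := by
          refine mul_le_mul (mul_le_mul_of_nonneg_left hw2 hγ)
            (mul_le_mul_of_nonneg_left he (abs_nonneg _)) (by positivity) (by positivity)
      _ = ‖e‖ * 2 * P.γ * |p| := by ring
  linarith

/-- **The lower energy bound**: `DH(y)·Y(y.1, y.2 + e) ≥ -‖e‖(∑|∂_{q_i}H| + 2γ∑|p_i|) - 2γ ∑ p_i²`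
(`γ ≥ 0`). [folklore] -/
theorem fderiv_hamiltonian_drift_ge (hU : ∀ i, ContDiff ℝ 1 (P.U i)) (hV : ∀ i, ContDiff ℝ 1 (P.V i))
    (hγ : 0 ≤ P.γ) (y : PhaseSpace N) (e : Fin N → ℝ) :
    -(‖e‖ * ((∑ i, |partialQ i (P.hamiltonian N) y|) + 2 * P.γ * ∑ i, |y.2 i|) +
        2 * P.γ * ∑ i, y.2 i ^ 2) ≤
      fderiv ℝ (P.hamiltonian N) y (P.langevinDrift N (y.1, y.2 + e)) := by
  rw [P.fderiv_hamiltonian_drift_eq_sum hU hV]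
  have hr : -(‖e‖ * ((∑ i, |partialQ i (P.hamiltonian N) y|) + 2 * P.γ * ∑ i, |y.2 i|) +
      2 * P.γ * ∑ i, y.2 i ^ 2) =
      ∑ i, (-(‖e‖ * |partialQ i (P.hamiltonian N) y|) - ‖e‖ * 2 * P.γ * |y.2 i| -
        2 * P.γ * y.2 i ^ 2) := by
    rw [mul_add, Finset.mul_sum, Finset.mul_sum, Finset.mul_sum, Finset.mul_sum]
    rw [show ∑ i, (-(‖e‖ * |partialQ i (P.hamiltonian N) y|) - ‖e‖ * 2 * P.γ * |y.2 i| -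
        2 * P.γ * y.2 i ^ 2) = -((∑ i, ‖e‖ * |partialQ i (P.hamiltonian N) y|) +
          ∑ i, ‖e‖ * (2 * P.γ * |y.2 i|)) - ∑ i, 2 * P.γ * y.2 i ^ 2 + 0 by
      rw [← Finset.sum_add_distrib, ← Finset.sum_neg_distrib, ← Finset.sum_sub_distrib, add_zero]
      exact Finset.sum_congr rfl fun i _ => by ring]
    ring
  rw [hr]
  refine Finset.sum_le_sum fun i _ => ?_
  set a := partialQ i (P.hamiltonian N) y
  set p := y.2 i
  have he : |e i| ≤ ‖e‖ := by rw [← Real.norm_eq_abs]; exact norm_le_pi_norm e i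
  have hw0 : 0 ≤ OscillatorChain.bathWeight N i := by
    unfold OscillatorChain.bathWeight; split_ifs <;> norm_num
  have hw2 : OscillatorChain.bathWeight N i ≤ 2 := by
    unfold OscillatorChain.bathWeight; split_ifs <;> norm_num
  have h1 : -(‖e‖ * |a|) ≤ a * e i := by
    have : |a * e i| ≤ ‖e‖ * |a| := by
      rw [abs_mul, mul_comm]
      exact mul_le_mul_of_nonneg_right he (abs_nonneg _)
    linarith [neg_abs_le (a * e i)]
  have h2 : -(2 * P.γ * p ^ 2) ≤ -(P.γ * OscillatorChain.bathWeight N i * p ^ 2) := by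
    have : P.γ * OscillatorChain.bathWeight N i * p ^ 2 ≤ P.γ * 2 * p ^ 2 :=
      mul_le_mul_of_nonneg_right (mul_le_mul_of_nonneg_left hw2 hγ) (sq_nonneg p)
    linarith
  have h3 : -(‖e‖ * 2 * P.γ * |p|) ≤ -(P.γ * OscillatorChain.bathWeight N i * p * e i) := by
    have : |P.γ * OscillatorChain.bathWeight N i * p * e i| ≤ ‖e‖ * 2 * P.γ * |p| := by
      calc |P.γ * OscillatorChain.bathWeight N i * p * e i|
          = P.γ * OscillatorChain.bathWeight N i * (|p| * |e i|) := by
            rw [abs_mul, abs_mul, abs_mul, abs_of_nonneg hγ, abs_of_nonneg hw0]; ring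
        _ ≤ P.γ * 2 * (|p| * ‖e‖) := by
            refine mul_le_mul (mul_le_mul_of_nonneg_left hw2 hγ)
              (mul_le_mul_of_nonneg_left he (abs_nonneg _)) (by positivity) (by positivity)
        _ = ‖e‖ * 2 * P.γ * |p| := by ring
    linarith [le_abs_self (P.γ * OscillatorChain.bathWeight N i * p * e i)]
  linarith

namespace UniformlyConfining

variable {P}

/-! ### Consequences of `UniformlyConfining`: regularity, positivity, coercivity of `H` -/

/-- Every `U i` is differentiable. [folklore] -/
theorem differentiable_U (hP : P.UniformlyConfining) (i : ℕ) : Differentiable ℝ (P.U i) :=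
  (hP.contDiff_U i).differentiable (by norm_num)

/-- Every `V i` is differentiable. [folklore] -/
theorem differentiable_V (hP : P.UniformlyConfining) (i : ℕ) : Differentiable ℝ (P.V i) :=
  (hP.contDiff_V i).differentiable (by norm_num)

/-- `H ∈ C²`. [folklore] -/
theorem contDiff_hamiltonian (hP : P.UniformlyConfining) (N : ℕ) : ContDiff ℝ 2 (P.hamiltonian N) :=
  P.contDiff_hamiltonian N hP.contDiff_U hP.contDiff_V

/-- `H` is differentiable. [folklore] -/
theorem differentiable_hamiltonian (hP : P.UniformlyConfining) (N : ℕ) : Differentiable ℝ (P.hamiltonian N) :=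
  (hP.contDiff_hamiltonian N).differentiable (by norm_num)

/-- `H ≥ 0`. [folklore] -/
theorem hamiltonian_nonneg (hP : P.UniformlyConfining) (N : ℕ) (x : PhaseSpace N) : 0 ≤ P.hamiltonian N x :=
  P.hamiltonian_nonneg_of_nonneg hP.U_nonneg hP.V_nonneg N x

/-- Positions with bounded pinning energy are bounded: `U_i(q) ≤ E ⟹ |q| ≤ R_i(E)`. [folklore] -/
theorem exists_abs_le_of_U_le (hP : P.UniformlyConfining) (i : ℕ) (E : ℝ) :
    ∃ R : ℝ, 0 ≤ R ∧ ∀ q, P.U i q ≤ E → |q| ≤ R := by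
  obtain ⟨K, hK, hKU⟩ := mem_cocompact.1 (hP.tendsto_U i (Ioi_mem_atTop E))
  obtain ⟨R, hR⟩ := hK.isBounded.subset_closedBall 0
  refine ⟨max R 0, le_max_right _ _, fun q hq => ?_⟩
  have hqK : q ∈ K := by
    by_contra h
    have h' : E < P.U i q := hKU h
    exact absurd hq (not_le.2 h')
  have := hR hqK
  rw [mem_closedBall, dist_zero_right, Real.norm_eq_abs] at this
  exact this.trans (le_max_left _ _)

/-- **Coercivity of the energy**: the sublevel sets `{H ≤ E}` are compact. [folklore] -/
theorem isCompact_setOf_hamiltonian_le (hP : P.UniformlyConfining) (N : ℕ) (E : ℝ) :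
    IsCompact {x : PhaseSpace N | P.hamiltonian N x ≤ E} := by
  choose R hR0 hR using fun i : Fin N => hP.exists_abs_le_of_U_le i.val E
  set Rmax : ℝ := ∑ i, R i with hRmax
  have hRi : ∀ i : Fin N, R i ≤ Rmax := fun i =>
    Finset.single_le_sum (f := R) (fun j _ => hR0 j) (Finset.mem_univ i)
  have hRmax0 : 0 ≤ Rmax := Finset.sum_nonneg fun j _ => hR0 j
  have hclosed : IsClosed {x : PhaseSpace N | P.hamiltonian N x ≤ E} :=
    isClosed_le (P.continuous_hamiltonian N (fun i => (hP.contDiff_U i).continuous)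
      (fun i => (hP.contDiff_V i).continuous)) continuous_const
  refine (isCompact_closedBall (0 : PhaseSpace N) (max Rmax (1 + |E|))).of_isClosed_subset hclosed ?_
  intro x hx
  have hx' : P.hamiltonian N x ≤ E := hx
  rw [mem_closedBall, dist_zero_right]
  have hsite := fun i => (P.site_le_hamiltonian hP.U_nonneg hP.V_nonneg N x i).trans hx'
  have h0 : 0 ≤ max Rmax (1 + |E|) := le_max_of_le_left hRmax0
  rw [Prod.norm_def, max_le_iff, pi_norm_le_iff_of_nonneg h0, pi_norm_le_iff_of_nonneg h0]
  refine ⟨fun i => ?_, fun i => ?_⟩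
  · rw [Real.norm_eq_abs]
    refine le_max_of_le_left ((hR i _ ?_).trans (hRi i))
    have := hsite i
    nlinarith [sq_nonneg (x.2 i)]
  · rw [Real.norm_eq_abs]
    refine le_max_of_le_right ?_
    have h1 := hsite i
    have h2 : x.2 i ^ 2 / 2 ≤ |E| := by linarith [hP.U_nonneg i.val (x.1 i), le_abs_self E]
    have h3 := abs_le_half_add_sq_half (x.2 i)
    linarith

/-! ### The constants of the energy balance -/

/-- The constant `A` of `|U_i'| ≤ A(1 + U_i)`. [folklore] -/
def forceConstU (hP : P.UniformlyConfining) : ℝ := Classical.choose hP.exists_abs_deriv_U_le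

/-- The constant `B` of `|V_i'| ≤ B(1 + V_i)`. [folklore] -/
def forceConstV (hP : P.UniformlyConfining) : ℝ := Classical.choose hP.exists_abs_deriv_V_le

/-- The defining property of `forceConstU`. [folklore] -/
theorem forceConstU_spec (hP : P.UniformlyConfining) :
    0 ≤ hP.forceConstU ∧ ∀ i q, |deriv (P.U i) q| ≤ hP.forceConstU * (1 + P.U i q) :=
  Classical.choose_spec hP.exists_abs_deriv_U_le

/-- The defining property of `forceConstV`. [folklore] -/
theorem forceConstV_spec (hP : P.UniformlyConfining) :
    0 ≤ hP.forceConstV ∧ ∀ i r, |deriv (P.V i) r| ≤ hP.forceConstV * (1 + P.V i r) :=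
  Classical.choose_spec hP.exists_abs_deriv_V_le

/-- **The energy-rate constant** `K_E = N (A + N² B) + γ (N + 2)` of the linear energy bound. [folklore] -/
def energyRate (hP : P.UniformlyConfining) (N : ℕ) : ℝ :=
  N * (hP.forceConstU + N ^ 2 * hP.forceConstV) + P.γ * (N + 2)

/-- `K_E ≥ 0`. [folklore] -/
theorem energyRate_nonneg (hP : P.UniformlyConfining) (N : ℕ) : 0 ≤ hP.energyRate N := by
  unfold energyRate
  have := hP.forceConstU_spec.1
  have := hP.forceConstV_spec.1
  have := hP.γ_nonneg
  positivity

/-- **The linear energy bound** `∑_i |∂_{q_i}H| + 2γ ∑_i |p_i| ≤ K_E (1 + H)`. [folklore] -/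
theorem linearEnergyBound (hP : P.UniformlyConfining) (N : ℕ) (x : PhaseSpace N) :
    (∑ i, |partialQ i (P.hamiltonian N) x|) + 2 * P.γ * ∑ i, |x.2 i| ≤
      hP.energyRate N * (1 + P.hamiltonian N x) := by
  have h1 := P.sum_abs_partialQ_hamiltonian_le hP.forceConstU_spec.1 hP.forceConstV_spec.1
    hP.forceConstU_spec.2 hP.forceConstV_spec.2 hP.U_nonneg hP.V_nonneg hP.differentiable_U
    hP.differentiable_V N x
  have h2 := P.sum_abs_momentum_le hP.U_nonneg hP.V_nonneg N x
  have hH0 := hP.hamiltonian_nonneg N x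
  have hγ := hP.γ_nonneg
  unfold energyRate
  have h3 : 2 * P.γ * ∑ i, |x.2 i| ≤ P.γ * (N + 2) * (1 + P.hamiltonian N x) := by
    have := mul_le_mul_of_nonneg_left h2 (by positivity : 0 ≤ 2 * P.γ)
    nlinarith [mul_nonneg hγ hH0, mul_nonneg (mul_nonneg hγ (Nat.cast_nonneg N)) hH0]
  nlinarith

/-! ### The Langevin drift is a regular confined drift -/

/-- **The Langevin drift of a site-dependent chain with confining potentials is a
`RegularConfinedDrift`**: energy `V = H` (`c = 1`), upper rate `K(M) = K_E M`, lower rate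
`K'(M) = K_E M + 4γ`, shift constant `N + 1`, radius `levelRadius H`, noise subspace = momentum
directions (twin of `OscillatorChain.IsConfining.confinedDrift`). [folklore] -/
def confinedDrift (hP : P.UniformlyConfining) (N : ℕ) : RegularConfinedDrift (P.langevinDrift N) :=
  have hH : Differentiable ℝ (P.hamiltonian N) := hP.differentiable_hamiltonian N
  have hU1 : ∀ i, ContDiff ℝ 1 (P.U i) := fun i => (hP.contDiff_U i).of_le (by norm_num)
  have hV1 : ∀ i, ContDiff ℝ 1 (P.V i) := fun i => (hP.contDiff_V i).of_le (by norm_num)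
  have hcpt : ∀ E : ℝ, IsCompact {x : PhaseSpace N | P.hamiltonian N x ≤ E} :=
    hP.isCompact_setOf_hamiltonian_le N
  { V := P.hamiltonian N
    c := 1
    K := fun M => hP.energyRate N * M
    ρ := levelRadius (P.hamiltonian N)
    noise := momentumSubspace N
    contDiff_drift := P.contDiff_one_langevinDrift hP.contDiff_U hP.contDiff_V N
    differentiable_energy := hH
    energy_nonneg := fun y => by linarith [hP.hamiltonian_nonneg N y]
    rate_nonneg := fun M hM => mul_nonneg (hP.energyRate_nonneg N) hM
    fderiv_energy_le := fun M y e he heM => by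
      rw [add_eq_of_mem_momentumSubspace he y]
      refine (P.fderiv_hamiltonian_drift_le hU1 hV1 hP.γ_nonneg y e.2).trans ?_
      have he2 : ‖e.2‖ ≤ M := (norm_eq_of_mem_momentumSubspace he) ▸ heM
      have hB := hP.linearEnergyBound N y
      have h0 : 0 ≤ (∑ i, |partialQ i (P.hamiltonian N) y|) + 2 * P.γ * ∑ i, |y.2 i| :=
        add_nonneg (Finset.sum_nonneg fun i _ => abs_nonneg _)
          (mul_nonneg (mul_nonneg (by norm_num) hP.γ_nonneg) (Finset.sum_nonneg fun i _ => abs_nonneg _))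
      calc ‖e.2‖ * ((∑ i, |partialQ i (P.hamiltonian N) y|) + 2 * P.γ * ∑ i, |y.2 i|)
          ≤ M * (hP.energyRate N * (1 + P.hamiltonian N y)) :=
            mul_le_mul he2 hB h0 ((norm_nonneg _).trans he2)
        _ = hP.energyRate N * M * (P.hamiltonian N y + 1) := by ring
    norm_le_radius := fun y B hy => norm_le_levelRadius hcpt hy
    radius_mono := levelRadius_mono hcpt
    K' := fun M => hP.energyRate N * M + 4 * P.γ
    Kshift := N + 1
    rate_mono := fun M M' h => mul_le_mul_of_nonneg_left h (hP.energyRate_nonneg N)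
    rate'_nonneg := fun M hM =>
      add_nonneg (mul_nonneg (hP.energyRate_nonneg N) hM) (mul_nonneg (by norm_num) hP.γ_nonneg)
    rate'_mono := fun M M' h => by
      have := mul_le_mul_of_nonneg_left h (hP.energyRate_nonneg N)
      linarith
    Kshift_nonneg := by positivity
    fderiv_energy_ge := fun M y e he heM => by
      rw [add_eq_of_mem_momentumSubspace he y]
      refine le_trans ?_ (P.fderiv_hamiltonian_drift_ge hU1 hV1 hP.γ_nonneg y e.2)
      have he2 : ‖e.2‖ ≤ M := (norm_eq_of_mem_momentumSubspace he) ▸ heM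
      have hB := hP.linearEnergyBound N y
      have hsq := P.sum_sq_momentum_le hP.U_nonneg hP.V_nonneg N y
      have hH0 := hP.hamiltonian_nonneg N y
      have hγ := hP.γ_nonneg
      have h0 : 0 ≤ (∑ i, |partialQ i (P.hamiltonian N) y|) + 2 * P.γ * ∑ i, |y.2 i| :=
        add_nonneg (Finset.sum_nonneg fun i _ => abs_nonneg _)
          (mul_nonneg (mul_nonneg (by norm_num) hγ) (Finset.sum_nonneg fun i _ => abs_nonneg _))
      have h1 : ‖e.2‖ * ((∑ i, |partialQ i (P.hamiltonian N) y|) + 2 * P.γ * ∑ i, |y.2 i|) ≤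
          M * (hP.energyRate N * (1 + P.hamiltonian N y)) :=
        mul_le_mul he2 hB h0 ((norm_nonneg _).trans he2)
      have h2 : 2 * P.γ * ∑ i, y.2 i ^ 2 ≤ 4 * P.γ * (P.hamiltonian N y + 1) := by
        have := mul_le_mul_of_nonneg_left hsq (by positivity : 0 ≤ 2 * P.γ)
        nlinarith
      nlinarith
    energy_shift_le := fun y e he he1 => by
      rw [add_eq_of_mem_momentumSubspace he y]
      have hne : ‖e‖ = ‖e.2‖ := norm_eq_of_mem_momentumSubspace he
      have he1' : ‖e.2‖ ≤ 1 := hne ▸ he1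
      refine (P.abs_hamiltonian_momentum_shift_le N y.1 y.2 he1').trans ?_
      rw [← hne]
      have hp := P.sum_abs_momentum_le hP.U_nonneg hP.V_nonneg N y
      have hH0 := hP.hamiltonian_nonneg N y
      have h0 : 0 ≤ ‖e‖ := norm_nonneg _
      have h1 : (∑ i, |y.2 i|) + N / 2 ≤ (N + 1) * (P.hamiltonian N y + 1) := by
        have hN : (0 : ℝ) ≤ N := Nat.cast_nonneg N
        nlinarith
      calc ‖e‖ * ((∑ i, |y.2 i|) + N / 2) ≤ ‖e‖ * ((N + 1) * (P.hamiltonian N y + 1)) :=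
            mul_le_mul_of_nonneg_left h1 h0
        _ = (N + 1) * ‖e‖ * (P.hamiltonian N y + 1) := by ring }

/-- The energy of `confinedDrift` is the Hamiltonian. [folklore] -/
@[simp] theorem confinedDrift_V (hP : P.UniformlyConfining) (N : ℕ) : (hP.confinedDrift N).V = P.hamiltonian N := rfl

/-- The noise subspace of `confinedDrift` is the momentum subspace. [folklore] -/
@[simp] theorem confinedDrift_noise (hP : P.UniformlyConfining) (N : ℕ) :
    (hP.confinedDrift N).noise = momentumSubspace N := rfl

/-- The bath directions lie in the noise subspace of `confinedDrift`. [folklore] -/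
theorem bathVec_mem_noise (hP : P.UniformlyConfining) (N k : ℕ) (c : ℝ) :
    bathVec N k c ∈ (hP.confinedDrift N).noise :=
  bathVec_mem_momentumSubspace N k c

end UniformlyConfining

end SiteChain

end Literature.MathematicalPhysics.KineticTheory.HeatConduction
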